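import Literature.Analysis.Calculus.ConstrainedCriticalFamily
import Mathlib.Analysis.Complex.Basic
import Mathlib.Topology.Algebra.Module.Star

/-!
# The implicit family of constrained critical points, II: conjugation symmetry — a holomorphic critical family is REAL ON REAL parameters

Topic `Literature/Analysis/Calculus`; continuation of `ConstrainedCriticalFamily` (same namespace).  Complex finite-dimensional normed spaces `E` (states), `F`
(constraint values) carrying CONJUGATIONS — continuous conjugate-linear involutions `cE : E →L⋆[ℂ] E`, `cF : F →L⋆[ℂ] F` (their fixed points are the «real» states ∕ values) —,
an action `a : E → ℂ` and a constraint `Φ : E → F` that are EQUIVARIANT: `a (cE x) = conj (a x)`, `Φ (cE x) = cF (Φ x)` (the complexifications of real-analytic real data restrict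
this way).  Then (§5) the derivatives at conjugate points are conjugate — `Da(cE x) = conj ∘ Da(x) ∘ cE`, `DΦ(cE x) = cF ∘ DΦ(x) ∘ cE` (Mathlib's `HasFDerivAt.comp_semilinear`) —, so the
Lagrange system `Da(x) = μ ∘ DΦ(x), Φ x = g` is carried to itself by `(g; x, μ) ↦ (cF g; cE x, conj ∘ μ ∘ cF)` (§6), and by the local uniqueness of the implicit family
(`exists_criticalFamily_master`) and the abstract equivariance lemma `criticalFamily_fixed_of_fixed` (v1.1): at a REAL base point (`cE x₀ = x₀`; the multiplier is then
automatically real, `DΦ(x₀)` being onto) the holomorphic family `γ` of constrained critical points takes REAL values at REAL parameters, `cF g = g ⇒ cE (γ g) = γ g` (§7,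
`exists_criticalFamily_real`).  This is the step by which an analytic extension «to Gᶜ-valued configurations» of a real variational solution is known to extend THE REAL
SOLUTION (T. Bałaban, Commun. Math. Phys. 102 (1985) 277–309, Prop. 9 p. 309: *«The minimal configuration U_k(V) … has an extension to an analytic function of Gᶜ-valued
small configurations V′»*; p. 307 «the equations … are valid for Gᶜ-valued fields»).  SOURCE FORMALISED for the mechanism: [LuenbergerYe2008] §10.7 Sensitivity Theorem
pp. 306–307 (the implicit-function construction, typed in part I) — the symmetry step is the uniqueness clause of the implicit function theorem applied to the transformed solution;
cited to [Balaban1985Variational] (181) p. 307 ∕ Prop. 9 p. 309 where print uses exactly this («by analyticity … we can extend it»).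

CONTENTS (theorems only; no `def`, no `instance`, no named fact, no `sorry`).  §5 `hasFDerivAt_conj_of_equivariant`, `fderiv_conj_of_equivariant` (vector-valued, two
conjugations), `hasFDerivAt_conj_of_equivariant_scalar`, `fderiv_conj_of_equivariant_scalar` (`ℂ`-valued, `conj` on the target).  §6 `lagrange_conj_equivariant` (the Lagrange
system is mapped to itself), `multiplier_real_of_real` (at a real state with `DΦ` onto, the multiplier is real).  §7 ★★ `exists_criticalFamily_real` (the master form of part I
VERBATIM plus the clause «real on real»), ★ `exists_criticalFamily_tangent_real` (tangent-form criticality + class near `g₀` + real on real).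
-/

noncomputable section

open scoped Topology ContDiff ComplexConjugate
open Set Filter Module

namespace Literature.Analysis.Calculus.ConstrainedCriticalFamily

variable {E : Type*} [NormedAddCommGroup E] [NormedSpace ℂ E]
  {F : Type*} [NormedAddCommGroup F] [NormedSpace ℂ F]
  {W : Type*} [NormedAddCommGroup W] [NormedSpace ℂ W]

/-! ## §5  Derivatives of conjugation-equivariant maps at conjugate points -/

section Deriv

/-- **THE DERIVATIVE OF AN EQUIVARIANT MAP AT THE CONJUGATE POINT** (vector-valued).  `cE`, `cW` continuous conjugate-linear involutions, `f (cE x) = cW (f x)` for all `x`;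
if `f` has derivative `f′` at `x` then it has derivative `cW ∘ f′ ∘ cE` (a ℂ-LINEAR map) at `cE x` — since `f = cW ∘ f ∘ cE`. [cite: Balaban1985Variational, p.307 («the equations … are valid for Gᶜ-valued fields»), (181) p.307] -/
theorem hasFDerivAt_conj_of_equivariant (cE : E →L⋆[ℂ] E) (cW : W →L⋆[ℂ] W) (hcE : ∀ x, cE (cE x) = x) (hcW : ∀ y, cW (cW y) = y)
    {f : E → W} (hf : ∀ x, f (cE x) = cW (f x)) {x : E} {f' : E →L[ℂ] W} (h : HasFDerivAt f f' x) :
    HasFDerivAt f (cW.comp (f'.comp cE)) (cE x) := by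
  have hfun : (cW ∘ f ∘ cE : E → W) = f := funext fun y => by
    show cW (f (cE y)) = f y
    rw [hf, hcW]
  have hx : HasFDerivAt f f' (cE (cE x)) := by rw [hcE]; exact h
  have key := hx.comp_semilinear cW cE
  rwa [hfun] at key

/-- `fderiv` form of `hasFDerivAt_conj_of_equivariant`. [cite: Balaban1985Variational, p.307, (181) p.307] -/
theorem fderiv_conj_of_equivariant (cE : E →L⋆[ℂ] E) (cW : W →L⋆[ℂ] W) (hcE : ∀ x, cE (cE x) = x) (hcW : ∀ y, cW (cW y) = y)
    {f : E → W} (hf : ∀ x, f (cE x) = cW (f x)) {x : E} (h : DifferentiableAt ℂ f x) :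
    fderiv ℂ f (cE x) = cW.comp ((fderiv ℂ f x).comp cE) :=
  (hasFDerivAt_conj_of_equivariant cE cW hcE hcW hf h.hasFDerivAt).fderiv

/-- **SCALAR CASE**: `a (cE x) = conj (a x)` ⇒ `Da(cE x) = conj ∘ Da(x) ∘ cE`. [cite: Balaban1985Variational, p.307, (181) p.307] -/
theorem hasFDerivAt_conj_of_equivariant_scalar (cE : E →L⋆[ℂ] E) (hcE : ∀ x, cE (cE x) = x)
    {a : E → ℂ} (ha : ∀ x, a (cE x) = conj (a x)) {x : E} {a' : E →L[ℂ] ℂ} (h : HasFDerivAt a a' x) :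
    HasFDerivAt a ((starL ℂ : ℂ ≃L⋆[ℂ] ℂ).toContinuousLinearMap.comp (a'.comp cE)) (cE x) :=
  hasFDerivAt_conj_of_equivariant cE (starL ℂ : ℂ ≃L⋆[ℂ] ℂ).toContinuousLinearMap hcE (fun y => star_star y)
    (fun y => by rw [ha]; rfl) h

/-- `fderiv` form of the scalar case. [cite: Balaban1985Variational, p.307, (181) p.307] -/
theorem fderiv_conj_of_equivariant_scalar (cE : E →L⋆[ℂ] E) (hcE : ∀ x, cE (cE x) = x)
    {a : E → ℂ} (ha : ∀ x, a (cE x) = conj (a x)) {x : E} (h : DifferentiableAt ℂ a x) :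
    fderiv ℂ a (cE x) = (starL ℂ : ℂ ≃L⋆[ℂ] ℂ).toContinuousLinearMap.comp ((fderiv ℂ a x).comp cE) :=
  (hasFDerivAt_conj_of_equivariant_scalar cE hcE ha h.hasFDerivAt).fderiv

end Deriv

/-! ## §6  The Lagrange system is conjugation-symmetric -/

section LagrangeSymm

variable (cE : E →L⋆[ℂ] E) (cF : F →L⋆[ℂ] F)

/-- **THE LAGRANGE SYSTEM IS MAPPED TO ITSELF BY CONJUGATION**: for equivariant `a`, `Φ` differentiable at `x`, if `Da(x) = μ ∘ DΦ(x)` and `Φ x = g` then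
`Da(cE x) = (conj ∘ μ ∘ cF) ∘ DΦ(cE x)` and `Φ (cE x) = cF g`. [cite: Balaban1985Variational, (181) p.307, Prop. 9 p.309; LuenbergerYe2008, §10.7 pp.306–307 (system (30)–(31))] -/
theorem lagrange_conj_equivariant (hcE : ∀ x, cE (cE x) = x) (hcF : ∀ y, cF (cF y) = y)
    {a : E → ℂ} {Φ : E → F} (ha : ∀ x, a (cE x) = conj (a x)) (hΦ : ∀ x, Φ (cE x) = cF (Φ x))
    {x : E} (hda : DifferentiableAt ℂ a x) (hdΦ : DifferentiableAt ℂ Φ x) {μ : F →L[ℂ] ℂ} {g : F}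
    (h : fderiv ℂ a x = μ.comp (fderiv ℂ Φ x) ∧ Φ x = g) :
    fderiv ℂ a (cE x) = ((starL ℂ : ℂ ≃L⋆[ℂ] ℂ).toContinuousLinearMap.comp (μ.comp cF)).comp (fderiv ℂ Φ (cE x)) ∧
      Φ (cE x) = cF g := by
  refine ⟨?_, by rw [hΦ, h.2]⟩
  rw [fderiv_conj_of_equivariant_scalar cE hcE ha hda, fderiv_conj_of_equivariant cE cF hcE hcF hΦ hdΦ, h.1]
  ext v
  simp only [ContinuousLinearMap.coe_comp, Function.comp_apply, ContinuousLinearEquiv.coe_coe, hcF]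

/-- **AT A REAL STATE WITH `DΦ` ONTO THE MULTIPLIER IS REAL**: `cE x = x`, `Da(x) = μ ∘ DΦ(x)`, `DΦ(x)` surjective ⇒ `conj ∘ μ ∘ cF = μ`.
[cite: Balaban1985Variational, (181) p.307; LuenbergerYe2008, §10.7 pp.306–307] -/
theorem multiplier_real_of_real (hcE : ∀ x, cE (cE x) = x) (hcF : ∀ y, cF (cF y) = y)
    {a : E → ℂ} {Φ : E → F} (ha : ∀ x, a (cE x) = conj (a x)) (hΦ : ∀ x, Φ (cE x) = cF (Φ x))
    {x : E} (hx : cE x = x) (hda : DifferentiableAt ℂ a x) (hdΦ : DifferentiableAt ℂ Φ x) {μ : F →L[ℂ] ℂ}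
    (h : fderiv ℂ a x = μ.comp (fderiv ℂ Φ x)) (honto : Function.Surjective (fderiv ℂ Φ x)) :
    (starL ℂ : ℂ ≃L⋆[ℂ] ℂ).toContinuousLinearMap.comp (μ.comp cF) = μ := by
  have h1 := (lagrange_conj_equivariant cE cF hcE hcF ha hΦ hda hdΦ (g := Φ x) ⟨h, rfl⟩).1
  rw [hx, h] at h1
  ext y
  obtain ⟨s, rfl⟩ := honto y
  have h2 := congrArg (fun φ : E →L[ℂ] ℂ => φ s) h1
  simp only [ContinuousLinearMap.coe_comp, Function.comp_apply] at h2
  exact h2.symm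

end LagrangeSymm

/-! ## §7  The holomorphic critical family is real on real parameters -/

section Real

variable [FiniteDimensional ℂ E] [FiniteDimensional ℂ F] {a : E → ℂ} {Φ : E → F}

/-- ★★ **THE IMPLICIT FAMILY OF CONSTRAINED CRITICAL POINTS OVER `ℂ` IS REAL ON REAL PARAMETERS** (master form).  Part I's `exists_criticalFamily_master` VERBATIM (scalars `ℂ`,
class `C^{m+1} ⇒ C^m`, `m = ω` allowed) for an action and a constraint EQUIVARIANT under conjugations `cE`, `cF` (continuous conjugate-linear involutions) at a REAL base state
`cE x₀ = x₀`, with ONE MORE CLAUSE: for `g` near `g₀ = Φ x₀`, `cF g = g ⇒ cE (γ g) = γ g` and the multiplier is real too.  Proof: the Lagrange system is carried to itself by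
`(g; x, μ) ↦ (cF g; cE x, conj ∘ μ ∘ cF)` (§6), which fixes the base point (the base multiplier is real by `multiplier_real_of_real`); local uniqueness (`criticalFamily_fixed_of_fixed`).
[cite: Balaban1985Variational, (181) p.307, Prop. 9 (190) p.309; LuenbergerYe2008, §10.7 Sensitivity Theorem pp.306–307] -/
theorem exists_criticalFamily_real {m : WithTop ℕ∞} (hm : m ≠ 0) {x₀ : E} {ℓ₀ : F →L[ℂ] ℂ}
    (ha : ContDiffAt ℂ (m + 1) a x₀) (hΦ : ContDiffAt ℂ (m + 1) Φ x₀)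
    (hcrit : fderiv ℂ a x₀ = ℓ₀.comp (fderiv ℂ Φ x₀))
    (honto : Function.Surjective (fderiv ℂ Φ x₀))
    (hnondeg : ∀ s : E, fderiv ℂ Φ x₀ s = 0 →
      (∀ t : E, fderiv ℂ Φ x₀ t = 0 → fderiv ℂ (fderiv ℂ a) x₀ s t - ℓ₀ (fderiv ℂ (fderiv ℂ Φ) x₀ s t) = 0) → s = 0)
    (cE : E →L⋆[ℂ] E) (cF : F →L⋆[ℂ] F) (hcE : ∀ x, cE (cE x) = x) (hcF : ∀ y, cF (cF y) = y)
    (haE : ∀ x, a (cE x) = conj (a x)) (hΦE : ∀ x, Φ (cE x) = cF (Φ x)) (hx₀ : cE x₀ = x₀) :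
    ∃ γ : F → E, ∃ Λ : F → (F →L[ℂ] ℂ), ∃ γ' : F →L[ℂ] E,
      γ (Φ x₀) = x₀ ∧ Λ (Φ x₀) = ℓ₀ ∧
      ContDiffAt ℂ m γ (Φ x₀) ∧ ContDiffAt ℂ m Λ (Φ x₀) ∧
      (∀ᶠ g in 𝓝 (Φ x₀), Φ (γ g) = g ∧ fderiv ℂ a (γ g) = (Λ g).comp (fderiv ℂ Φ (γ g))) ∧
      (∀ᶠ w in 𝓝 (Φ x₀, (x₀, ℓ₀)),
        (fderiv ℂ a w.2.1 = (w.2.2).comp (fderiv ℂ Φ w.2.1) ∧ Φ w.2.1 = w.1) ↔ (γ w.1, Λ w.1) = w.2) ∧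
      HasStrictFDerivAt γ γ' (Φ x₀) ∧
      (∀ h : F, fderiv ℂ Φ x₀ (γ' h) = h ∧
        ∀ t : E, fderiv ℂ Φ x₀ t = 0 → fderiv ℂ (fderiv ℂ a) x₀ (γ' h) t - ℓ₀ (fderiv ℂ (fderiv ℂ Φ) x₀ (γ' h) t) = 0) ∧
      (∀ᶠ g in 𝓝 (Φ x₀), cF g = g →
        cE (γ g) = γ g ∧ (starL ℂ : ℂ ≃L⋆[ℂ] ℂ).toContinuousLinearMap.comp ((Λ g).comp cF) = Λ g) := by
  obtain ⟨γ, Λ, γ', h0, h0', hc, hc', hid, huniq, hd, hlin⟩ := exists_criticalFamily_master hm ha hΦ hcrit honto hnondeg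
  -- differentiability of `a`, `Φ` near `x₀`
  have hda : ∀ᶠ x in 𝓝 x₀, DifferentiableAt ℂ a x := by
    obtain ⟨a', u, hu, -, hua⟩ := contDiffAt_one_iff.1 (ha.of_le le_add_self)
    filter_upwards [hu] with x hx using (hua x hx).differentiableAt
  have hdΦ : ∀ᶠ x in 𝓝 x₀, DifferentiableAt ℂ Φ x := by
    obtain ⟨Φ', u, hu, -, huΦ⟩ := contDiffAt_one_iff.1 (hΦ.of_le le_add_self)
    filter_upwards [hu] with x hx using (huΦ x hx).differentiableAt
  -- the symmetry of the multipliers and its continuity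
  set σD : (F →L[ℂ] ℂ) → (F →L[ℂ] ℂ) := fun μ => (starL ℂ : ℂ ≃L⋆[ℂ] ℂ).toContinuousLinearMap.comp (μ.comp cF) with hσD
  have hσDcont : Continuous σD := by
    refine continuous_iff_continuousAt.2 fun μ₀ => ?_
    refine (LipschitzWith.of_dist_le_mul (K := ⟨‖(starL ℂ : ℂ ≃L⋆[ℂ] ℂ).toContinuousLinearMap‖ * ‖cF‖, by positivity⟩) fun μ μ' => ?_).continuous.continuousAt
    rw [dist_eq_norm, dist_eq_norm]
    have hsub : σD μ - σD μ' = (starL ℂ : ℂ ≃L⋆[ℂ] ℂ).toContinuousLinearMap.comp ((μ - μ').comp cF) := by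
      rw [hσD]; ext y; simp
    rw [hsub]
    calc ‖(starL ℂ : ℂ ≃L⋆[ℂ] ℂ).toContinuousLinearMap.comp ((μ - μ').comp cF)‖
        ≤ ‖(starL ℂ : ℂ ≃L⋆[ℂ] ℂ).toContinuousLinearMap‖ * ‖(μ - μ').comp cF‖ := ContinuousLinearMap.opNorm_comp_le _ _
      _ ≤ ‖(starL ℂ : ℂ ≃L⋆[ℂ] ℂ).toContinuousLinearMap‖ * (‖μ - μ'‖ * ‖cF‖) :=
          mul_le_mul_of_nonneg_left (ContinuousLinearMap.opNorm_comp_le _ _) (norm_nonneg _)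
      _ = (‖(starL ℂ : ℂ ≃L⋆[ℂ] ℂ).toContinuousLinearMap‖ * ‖cF‖) * ‖μ - μ'‖ := by ring
  -- base point data
  have hg₀ : cF (Φ x₀) = Φ x₀ := by rw [← hΦE, hx₀]
  have hℓ₀ : σD ℓ₀ = ℓ₀ := by
    rw [hσD]
    exact multiplier_real_of_real cE cF hcE hcF haE hΦE hx₀ hda.self_of_nhds hdΦ.self_of_nhds hcrit honto
  -- the Lagrange system is carried to itself near the base point
  have hP : ∀ᶠ w in 𝓝 (Φ x₀, (γ (Φ x₀), Λ (Φ x₀))),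
      (fderiv ℂ a w.2.1 = (w.2.2).comp (fderiv ℂ Φ w.2.1) ∧ Φ w.2.1 = w.1) →
        (fderiv ℂ a (cE w.2.1) = (σD w.2.2).comp (fderiv ℂ Φ (cE w.2.1)) ∧ Φ (cE w.2.1) = cF w.1) := by
    rw [h0, h0']
    have hx : ∀ᶠ w : F × (E × (F →L[ℂ] ℂ)) in 𝓝 (Φ x₀, (x₀, ℓ₀)), DifferentiableAt ℂ a w.2.1 ∧ DifferentiableAt ℂ Φ w.2.1 := by
      have ht : Tendsto (fun w : F × (E × (F →L[ℂ] ℂ)) => w.2.1) (𝓝 (Φ x₀, (x₀, ℓ₀))) (𝓝 x₀) :=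
        (continuous_fst.comp continuous_snd).continuousAt.tendsto
      exact ht.eventually (hda.and hdΦ)
    filter_upwards [hx] with w hw hPw
    rw [hσD]
    exact lagrange_conj_equivariant cE cF hcE hcF haE hΦE hw.1 hw.2 hPw
  have huniq' : ∀ᶠ w in 𝓝 (Φ x₀, (γ (Φ x₀), Λ (Φ x₀))),
      (fderiv ℂ a w.2.1 = (w.2.2).comp (fderiv ℂ Φ w.2.1) ∧ Φ w.2.1 = w.1) ↔ (γ w.1, Λ w.1) = w.2 := by
    rw [h0, h0']; exact huniq
  have hfix := criticalFamily_fixed_of_fixed (P := fun w : F × (E × (F →L[ℂ] ℂ)) =>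
      fderiv ℂ a w.2.1 = (w.2.2).comp (fderiv ℂ Φ w.2.1) ∧ Φ w.2.1 = w.1)
    (σF := cF) (σE := cE) (σD := σD) huniq' hc.continuousAt hc'.continuousAt
    cF.continuous.continuousAt cE.continuous.continuousAt hσDcont.continuousAt
    hg₀ (by rw [h0, hx₀]) (by rw [h0', hℓ₀]) hP
  refine ⟨γ, Λ, γ', h0, h0', hc, hc', hid, huniq, hd, hlin, ?_⟩
  filter_upwards [hfix] with g hg hreal
  have h := hg hreal
  rw [hσD] at h
  exact h

/-- ★ **TANGENT-FORM CRITICALITY, THE CLASS NEAR `g₀`, AND REAL ON REAL** — part I's `exists_criticalFamily_tangent` plus the realness clause: for `g` near `g₀`, `γ g` lies on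
`{Φ = g}`, `Da(γ g)` kills `ker DΦ(γ g)`, `γ` is `C^m` at `g` (analytic near `g₀` for `m = ω`), and `cF g = g ⇒ cE (γ g) = γ g`. [cite: Balaban1985Variational, (181) p.307, Prop. 9 (190) p.309; LuenbergerYe2008, §10.7 Sensitivity Theorem pp.306–307] -/
theorem exists_criticalFamily_tangent_real {m : WithTop ℕ∞} (hm : m ≠ 0) (hm' : m ≠ (⊤ : ℕ∞)) {x₀ : E} {ℓ₀ : F →L[ℂ] ℂ}
    (ha : ContDiffAt ℂ (m + 1) a x₀) (hΦ : ContDiffAt ℂ (m + 1) Φ x₀)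
    (hcrit : fderiv ℂ a x₀ = ℓ₀.comp (fderiv ℂ Φ x₀))
    (honto : Function.Surjective (fderiv ℂ Φ x₀))
    (hnondeg : ∀ s : E, fderiv ℂ Φ x₀ s = 0 →
      (∀ t : E, fderiv ℂ Φ x₀ t = 0 → fderiv ℂ (fderiv ℂ a) x₀ s t - ℓ₀ (fderiv ℂ (fderiv ℂ Φ) x₀ s t) = 0) → s = 0)
    (cE : E →L⋆[ℂ] E) (cF : F →L⋆[ℂ] F) (hcE : ∀ x, cE (cE x) = x) (hcF : ∀ y, cF (cF y) = y)
    (haE : ∀ x, a (cE x) = conj (a x)) (hΦE : ∀ x, Φ (cE x) = cF (Φ x)) (hx₀ : cE x₀ = x₀) :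
    ∃ γ : F → E, γ (Φ x₀) = x₀ ∧ ContDiffAt ℂ m γ (Φ x₀) ∧
      ∀ᶠ g in 𝓝 (Φ x₀), Φ (γ g) = g ∧ ContDiffAt ℂ m γ g ∧
        (∀ t : E, fderiv ℂ Φ (γ g) t = 0 → fderiv ℂ a (γ g) t = 0) ∧ (cF g = g → cE (γ g) = γ g) := by
  obtain ⟨γ, Λ, -, h0, -, hc, -, hid, -, -, -, hreal⟩ :=
    exists_criticalFamily_real hm ha hΦ hcrit honto hnondeg cE cF hcE hcF haE hΦE hx₀
  refine ⟨γ, h0, hc, ?_⟩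
  filter_upwards [hid, hc.eventually hm', hreal] with g hg hcg hrg
  refine ⟨hg.1, hcg, fun t ht => ?_, fun hfix => (hrg hfix).1⟩
  rw [hg.2, ContinuousLinearMap.coe_comp, Function.comp_apply, ht, map_zero]

end Real

end Literature.Analysis.Calculus.ConstrainedCriticalFamily

end
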